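import Literature.AnabelianGeometry.EtaleTheta.FrobenioidThetaBiKummer
import Literature.AnabelianGeometry.EtaleTheta.BiKummerRoots

/-!
# [EtTh] §5 merge adapter (Prop. 5.2 (i)): the bi-Kummer vocabulary stub over the REAL §4 structures (pp. 314, 318–319, 324 / PDF pp. 88, 92–93, 98)

Mochizuki, *The étale theta function …*, Publ. RIMS **45** (2009)
[cite: MochizukiEtTh2009, Prop 5.2 (i) p.324 (PDF p.98)].  Seat abc-iut-L2-t4 (§5 owner), MERGE-PLAN row 4
(HOME/staging/L2/L2-t4/MERGE-PLAN.md) — ADDITIVE: no landed file is edited.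

Proposition 5.2 (i) (`FrobenioidThetaBiKummer.ThetaPairIsRoot`, landed p406884/p410060) says that
"the pair of morphisms of `C` determined by '`s_{l·N}`', '`τ_{l·N}`' constitutes an `l·N`-th root of a right
fraction-pair [cf. Proposition 4.2, (iii)] of … the theta function `Θ̈` … or, alternatively, an `N`-th root of a
right fraction-pair … of … an `l`-th root of the theta function `Θ̈` [cf. Remark 4.3.2]"; it is typed over the
vocabulary stub `FrobenioidThetaBiKummer.BiKummerVocabStub 𝔉` (`IsRootOfRightFractionPair`, `IsRootOf`,
`TODO-merge(abc-iut-L2-t3)`) because §4 had no tree decls when §5 was typed.  It now has: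
abc-iut-L2-t3's `BiKummerSetting` (Def. 4.1: `FractionPair f B` = a right fraction-pair of
`f ∈ O^×(A^birat)` with codomain `B`) and `BiKummerSetting.NthRoot f P N pullFrac` (Prop. 4.2 (iii): an
`N`-th root `(A_N, B_N, α, β, f_N, (s'_N, s''_N))` of the fraction-pair `P`), with the canonical model instance
`BiKummerSetting.mkOfModelCanonical` (abc-iut-L2-t9, p411516) over the tempered Frobenioid of Def. 3.6.
This file INSTANTIATES the stub from those structures (`BiKummerVocabStub.ofBiKummerSetting`) for any §5
data `𝔉` over the setting's category `S.C`, given the identification `e` of `𝔉`'s birational units with the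
setting's (`𝔉.biratUnits A ≃* S.biratUnits A`; both are the model's `B(A^bs)^×` for abc-iut-L2-t9's
`thetaStub` / `mkOfModel`, where `e` is the identity) and the pull-back of birational units `pullFrac`
(the parameter of abc-iut-L2-t3's `NthRoot`; the model's `TemperedFrobenioid.pullFracModel`):
* "`(s, s')` [: `S' → T'`] constitutes an `M`-th root of a right fraction-pair of `f` [∈ `O^×(A^birat)`]"
  := there are a right fraction-pair `P` of `f` and an `M`-th root `R` of `P` (Prop. 4.2 (iii)) whose root
  pair `(s'_M, s''_M) : A_M → B_M` is `(s, s')` up to isomorphisms `ζ_A : A_M ⥲ S'`, `ζ_B : B_M ⥲ T'` of `C`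
  — READING (recorded, not hidden): `N`-th roots are determined exactly up to such isomorphisms
  (Prop. 4.2 (iv) "an isomorphism between the two given `N`-th roots", p.315 (PDF p.89)), so "constitutes an
  `M`-th root" is rendered invariantly as "is isomorphic, as a pair of arrows, to the root pair of an
  `M`-th root";
* "`g` [∈ `O^×(A'^birat)`] is an `M`-th root of `f`" (Rmk. 4.3.2, pp.318–319 (PDF pp.92–93): roots on the
  `M`-domain `A_M → A` of base-Frobenius type, `f_M^M = f|_{A_M}`) := `g` is, up to an isomorphism
  `A_M ⥲ A'`, the root element `f_M` of an `M`-th root of some right fraction-pair of `f`.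
Then `thetaPairIsRoot_ofBiKummerSetting_iff` unfolds Prop. 5.2 (i) at this instance into a statement about
`FractionPair`/`NthRoot` of `Θ̈` (no stub left), and `pairIsNthRootOf_nthRoot` records that a genuine `N`-th
root satisfies the predicate.  HONEST FRAMING: definitions + `rfl`-level lemmas; nothing of [EtTh] is
asserted; Prop. 5.2 (i) is NOT proved here (that is the construction of the genuine §5 data, MERGE-PLAN §2);
no side is taken on any disputed claim downstream.
-/

noncomputable section

namespace Literature.AnabelianGeometry.EtaleTheta

open CategoryTheory Opposite Literature.AlgebraicGeometry.Frobenioids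

universe u₀ v₀ u v w w'

variable {K : Type u₀} [Field K]

namespace BiKummerSetting

variable {X : SemiGraphs.TemperedArithmeticGroup.{u₀} K} {D₀ : Type u₀} [Category.{v₀} D₀]
  {V : FrdIMonoidStub.{w}} {T : RealifiedDivisorMonoids (D₀ := D₀) V} {D : Type u} [Category.{v} D]
  {VD : FrdICatStub.{u, v, w} D} (S : BiKummerSetting X T D VD)
  (pullFrac : ∀ {A A' : S.C} (_ : A' ⟶ A), S.biratUnits A → S.biratUnits A')

/-- **"`(s, s')` constitutes an `M`-th root of a right fraction-pair of `f`"** ([EtTh] Prop. 4.2 (iii), p.314 (PDF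
p.88); the phrase of Prop. 5.2 (i), p.324 (PDF p.98)), for `f ∈ O^×(A^birat)` and a pair of arrows
`s, s' : S' → T'` of `C`: there exist a right fraction-pair `P` of `f` (Def. 4.1 (i)) and an `M`-th root
`R = (A_M, B_M, α, β, f_M, (s'_M, s''_M))` of `P` together with isomorphisms `ζ_A : A_M ⥲ S'`,
`ζ_B : B_M ⥲ T'` carrying `(s'_M, s''_M)` to `(s, s')` (roots are determined up to exactly such isomorphisms,
Prop. 4.2 (iv), p.315 (PDF p.89)).  [cite: MochizukiEtTh2009, Prop 4.2 (iii) p.314 (PDF p.88); Prop 5.2 (i) p.324 (PDF p.98)] -/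
def PairIsNthRootOf (M : ℕ) {A S' T' : S.C} (f : S.biratUnits A) (s s' : S' ⟶ T') : Prop :=
  ∃ (hM : 0 < M) (B : S.C) (P : S.FractionPair f B) (R : S.NthRoot f P ⟨M, hM⟩ pullFrac)
    (ζA : R.AN ≅ S') (ζB : R.BN ≅ T'),
    ζA.inv ≫ R.pair.num ≫ ζB.hom = s ∧ ζA.inv ≫ R.pair.den ≫ ζB.hom = s'

/-- **"`g` is an `M`-th root of `f`"** for `g ∈ O^×(A'^birat)`, `f ∈ O^×(A^birat)` ([EtTh] Rmk. 4.3.2, pp.318–319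
(PDF pp.92–93), with Prop. 4.2 (iii): the root element `f_M ∈ O^×(A_M^birat)`, `f_M^M = f|_{A_M}`, on the
`M`-domain `A_M → A`): `g` is, along an isomorphism `ζ : A_M ⥲ A'` of `C`, the root element of an `M`-th root
of some right fraction-pair of `f`.  [cite: MochizukiEtTh2009, Rmk 4.3.2 p.318 (PDF p.92); Prop 4.2 (iii) p.314 (PDF p.88)] -/
def IsNthRootOf (M : ℕ) {A' A : S.C} (g : S.biratUnits A') (f : S.biratUnits A) : Prop :=
  ∃ (hM : 0 < M) (B : S.C) (P : S.FractionPair f B) (R : S.NthRoot f P ⟨M, hM⟩ pullFrac)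
    (ζ : R.AN ≅ A'), pullFrac ζ.inv R.root = g

/-- The root pair `(s'_N, s''_N)` of a genuine `N`-th root is an `N`-th root of a right fraction-pair of `f`
in the above sense (take `ζ_A, ζ_B` the identities).  [cite: MochizukiEtTh2009, Prop 4.2 (iii) p.314 (PDF p.88)] -/
theorem pairIsNthRootOf_nthRoot {A B : S.C} {f : S.biratUnits A} {P : S.FractionPair f B} {N : ℕ+}
    (R : S.NthRoot f P N pullFrac) :
    S.PairIsNthRootOf pullFrac (N : ℕ) f R.pair.num R.pair.den :=
  ⟨N.pos, B, P, R, Iso.refl _, Iso.refl _, by simp, by simp⟩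

/-- Monotonicity of the reading in the isomorphisms: an `M`-th root pair stays one after composing with
isomorphisms `S' ⥲ S''`, `T' ⥲ T''` (the `ζ_A, ζ_B`-freedom of Prop. 4.2 (iv)).
[cite: MochizukiEtTh2009, Prop 4.2 (iv) p.315 (PDF p.89)] -/
theorem PairIsNthRootOf.of_iso {M : ℕ} {A S' T' S'' T'' : S.C} {f : S.biratUnits A} {s s' : S' ⟶ T'}
    (h : S.PairIsNthRootOf pullFrac M f s s') (a : S' ≅ S'') (b : T' ≅ T'') :
    S.PairIsNthRootOf pullFrac M f (a.inv ≫ s ≫ b.hom) (a.inv ≫ s' ≫ b.hom) := by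
  obtain ⟨hM, B, P, R, ζA, ζB, h1, h2⟩ := h
  refine ⟨hM, B, P, R, ζA ≪≫ a, ζB ≪≫ b, ?_, ?_⟩
  · rw [← h1]; simp
  · rw [← h2]; simp

end BiKummerSetting

namespace FrobenioidThetaBiKummer

variable {X : SemiGraphs.TemperedArithmeticGroup.{u₀} K} {D₀ : Type u₀} [Category.{v₀} D₀]
  {V : FrdIMonoidStub.{w}} {T : RealifiedDivisorMonoids (D₀ := D₀) V} {D : Type u} [Category.{v} D]
  {VD : FrdICatStub.{u, v, w} D} (S : BiKummerSetting X T D VD)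
  (pullFrac : ∀ {A A' : S.C} (_ : A' ⟶ A), S.biratUnits A → S.biratUnits A')
  (𝔉 : ThetaFrobenioid.{w'} S.C D) (e : ∀ A : S.C, 𝔉.biratUnits A ≃* S.biratUnits A)

/-- **The Prop. 5.2 (i) vocabulary stub INSTANTIATED over abc-iut-L2-t3's §4 structures**: for §5 data `𝔉` over
the category `S.C` of a bi-Kummer setting `S` (Def. 4.1), with `𝔉`'s birational units identified with `S`'s
by `e` and pull-back of birational units `pullFrac`: "`(s, s')` is an `M`-th root of a right fraction-pair of
`f`" := `S.PairIsNthRootOf`, "`g` is an `M`-th root of `f`" := `S.IsNthRootOf`.  For abc-iut-L2-t9's model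
data (`thetaStub`, `mkOfModelCanonical`) both unit groups are `B(A^bs)^×` and `e` is the identity,
`pullFrac = TemperedFrobenioid.pullFracModel`.  [cite: MochizukiEtTh2009, Prop 5.2 (i) p.324 (PDF p.98)] -/
def BiKummerVocabStub.ofBiKummerSetting : BiKummerVocabStub 𝔉 where
  IsRootOfRightFractionPair M A _ _ f s s' := S.PairIsNthRootOf pullFrac M (e A f) s s'
  IsRootOf M A' A g f := S.IsNthRootOf pullFrac M (e A' g) (e A f)

/-- **[EtTh] Proposition 5.2 (i) at the real vocabulary, unfolded** (no stub left): `ThetaPairIsRoot 𝔉 V` for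
`V = ofBiKummerSetting S pullFrac 𝔉 e` says — (first alternative) `(s^⊓_N, s^⊔_N)` is, up to isomorphism of
roots, the root pair of an `l·N`-th root (Prop. 4.2 (iii)) of a right fraction-pair of `Θ̈ ∈ O^×(A_⊚^birat)`, and
(second alternative) for some `g ∈ O^×(A'^birat)` that is an `l`-th root of `Θ̈` (Rmk. 4.3.2), `(s^⊓_N, s^⊔_N)`
is the root pair of an `N`-th root of a right fraction-pair of `g`.
[cite: MochizukiEtTh2009, Prop 5.2 (i) p.324 (PDF p.98)] -/
theorem thetaPairIsRoot_ofBiKummerSetting_iff :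
    ThetaPairIsRoot 𝔉 (BiKummerVocabStub.ofBiKummerSetting S pullFrac 𝔉 e) ↔
      S.PairIsNthRootOf pullFrac (𝔉.l * 𝔉.N) (e _ 𝔉.thetaFn) 𝔉.sCap 𝔉.sCup ∧
        ∃ (A' : S.C) (g : 𝔉.biratUnits A'), S.IsNthRootOf pullFrac 𝔉.l (e A' g) (e _ 𝔉.thetaFn) ∧
          S.PairIsNthRootOf pullFrac 𝔉.N (e A' g) 𝔉.sCap 𝔉.sCup :=
  Iff.rfl

/-- The second alternative of Prop. 5.2 (i) at the real vocabulary, with the intermediate `l`-th root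
quantified over the SETTING's units (the identification `e` being bijective).
[cite: MochizukiEtTh2009, Prop 5.2 (i) p.324 (PDF p.98)] -/
theorem thetaPairIsRoot_ofBiKummerSetting_iff' :
    ThetaPairIsRoot 𝔉 (BiKummerVocabStub.ofBiKummerSetting S pullFrac 𝔉 e) ↔
      S.PairIsNthRootOf pullFrac (𝔉.l * 𝔉.N) (e _ 𝔉.thetaFn) 𝔉.sCap 𝔉.sCup ∧
        ∃ (A' : S.C) (g : S.biratUnits A'), S.IsNthRootOf pullFrac 𝔉.l g (e _ 𝔉.thetaFn) ∧
          S.PairIsNthRootOf pullFrac 𝔉.N g 𝔉.sCap 𝔉.sCup := by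
  rw [thetaPairIsRoot_ofBiKummerSetting_iff]
  refine and_congr_right fun _ => ⟨?_, ?_⟩
  · rintro ⟨A', g, hg⟩
    exact ⟨A', e A' g, hg⟩
  · rintro ⟨A', g, hg⟩
    exact ⟨A', (e A').symm g, by simpa using hg⟩

end FrobenioidThetaBiKummer

end Literature.AnabelianGeometry.EtaleTheta

end
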